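import Mathlib
import Literature.Analysis.FluidPDE.Tao2016AveragedNS.BoundedEternalSolutions
import HarnessLib

/-!
# `WakeRatchet.TailRatchet` (stmt-NavierStokesRegularity-21808) and the SEEDED GRADED TODA MEMBER
# `T_ε ∈ E₂(2/ε)` of Tao's table class — the table of the tree's PROVED `PerpetualPump.CircuitPump`
# Part I: membership in `E₂(2/ε)` and the drive coordinates (Part II: `…SeededTodaWaves`)

WHY THIS FILE.  The crux is refuted modulo admissible (block-)DSS eternal solutions on ONE table of a
FIXED class `E₂(R)` at arbitrarily small scale ratios (tree: `tailRatchet_false_of_persistentDSSWaves`,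
`tailRatchet_false_of_persistent_blockDSS_visc`).  The only exact DSS cascade solutions the tree owns
are those of `PerpetualPump.CircuitPump` (stmt-1834, PROVED, ≈ 9.7k lines: clock box → truncated
flows + Schauder clamp covering → truncation limit → DSS unrolling), built on the m = 2 SEEDED GRADED
TODA table with seed `ε`:
  `ȧ_n = −ν(1+ε₀)^{2n} a_n − Λⁿ v_n² + Λ^{n−1} v_{n−1}² − ε Λⁿ a_n v_n`,
  `v̇_n = −ν(1+ε₀)^{2n} v_n + Λⁿ v_n (a_n − a_{n+1}) + ε Λⁿ a_n²`,   `Λ = (1+ε₀)^{5/2}`.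
Here we (1) write that table in the TREE'S vocabulary (`Fin 4` components, shifts in `ℤ³`; carrier =
component `0`, bond = component `1`, components `2, 3` inert) and prove it is a member of Tao's class
`InTableClass (2/ε)` for `0 < ε ≤ 1` (symmetric (4.2), cancelling (4.3), `2/ε`-comparable) — the
«Toda member `T_ε ∈ E₂(2/ε)`» named in the route's `why it might fail`; (2) compute its drive
coordinates; and in Part II (`…SeededTodaWaves`): (3) record the two KILL CRITERIA at FIXED seed: admissible DSS waves, or uniformly bounded
admissible viscous block-DSS eternal solutions, of `T_ε` (ε fixed) at arbitrarily small `ε₀` refute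
`TailRatchet`; (4) prove that the UNSEEDED member `T_0 ∈ E₂(2)` carries NO non-trivial admissible DSS
wave at all (its bond row is multiplicative: `WakeRatchetMultiplicativeNoGo`, here in the sharper
integrable-multiplier form `eq_zero_of_hasDerivAt_damped_mul_integrable`).

READING FOR THE CENSUS.  `CircuitPump`'s solutions are exactly the objects of kill criterion (3) EXCEPT
that its seed is chosen `ε = ε(λ) → 0` as `λ ↓ 1` (`PerpetualPumpCircuitPumpClockBoxEps`: e.g. the
condition `A₂² ε^{3/20} ≤ 1/2` with `A₂ ≍ log(1/ε)/(λ^{1/5} − 1)`), i.e. spread `2/ε(λ) → ∞`, outside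
every fixed `InTableClass R` — and `TailRatchet` fixes `R` before `ε_s`.  So the construction that would
close stmt-21808 as REFUTED through this door is precisely: CircuitPump's clock box (its stub A) made
UNIFORM IN `λ ↓ 1` AT FIXED SEED `ε` (stubs C1, C2, D, E of that line are seed-independent), plus the
admissibility decay of the resulting orbit; by (4) the seed cannot be dropped.

HONEST FRAMING: MODEL lattice ODEs only (Tao 2016 §4); nothing here concerns the Navier–Stokes
equations; stmt-21808 is neither proved nor refuted here (negative lemmas modulo a construction, and
one unconditional no-go for the unseeded member).
-/

noncomputable section

set_option linter.dupNamespace false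

namespace Summit.NavierStokesRegularity.NavierStokesRegularity.Theorems

namespace WakeRatchetSeededToda

open Literature.Analysis.FluidPDE Literature.Analysis.FluidPDE.TaoCascade

/-! ## The seeded graded Toda table `T_ε` is a member of `E₂(2/ε)`

The table is written out explicitly (no `def`): carrier = component `0`, bond = component `1`,
components `2, 3` inert; same-scale entries `(1,1,0) ↦ −1`, `(1,0,1), (0,1,1) ↦ ½`, seed
`(0,0,1) ↦ ε`, `(0,1,0), (1,0,0) ↦ −ε/2` at shift `(0,0,0)`; feed `(1,1,0) ↦ 1` at shift `(0,0,1)`;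
drain `(1,0,1) ↦ −½` at `(0,1,0)` and `(0,1,1) ↦ −½` at `(1,0,0)`; all other entries `0`. -/

/-- **Symmetry (4.2)** of the seeded graded Toda table (any seed `ε`).
[cite: Tao2016AveragedNS, §4 (4.2); cell theorem (the table of `PerpetualPump.CircuitPump` in tree vocabulary)] -/
theorem seededToda_isSymmetricCoeff (ε : ℝ) :
    IsSymmetricCoeff (m := 4) (fun (i₁ i₂ i₃ : Fin 4) (μ : ℤ × ℤ × ℤ) =>
      if μ = ((0 : ℤ), (0 : ℤ), (0 : ℤ)) then
        (if i₁ = 1 ∧ i₂ = 1 ∧ i₃ = 0 then (-1 : ℝ) else if i₁ = 1 ∧ i₂ = 0 ∧ i₃ = 1 then 1 / 2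
         else if i₁ = 0 ∧ i₂ = 1 ∧ i₃ = 1 then 1 / 2 else if i₁ = 0 ∧ i₂ = 0 ∧ i₃ = 1 then ε
         else if i₁ = 0 ∧ i₂ = 1 ∧ i₃ = 0 then -ε / 2 else if i₁ = 1 ∧ i₂ = 0 ∧ i₃ = 0 then -ε / 2 else 0)
      else if μ = ((0 : ℤ), (0 : ℤ), (1 : ℤ)) then (if i₁ = 1 ∧ i₂ = 1 ∧ i₃ = 0 then 1 else 0)
      else if μ = ((0 : ℤ), (1 : ℤ), (0 : ℤ)) then (if i₁ = 1 ∧ i₂ = 0 ∧ i₃ = 1 then -1 / 2 else 0)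
      else if μ = ((1 : ℤ), (0 : ℤ), (0 : ℤ)) then (if i₁ = 0 ∧ i₂ = 1 ∧ i₃ = 1 then -1 / 2 else 0)
      else 0) := by
  intro i₁ i₂ i₃ μ₁ μ₂ μ₃ hμ
  rw [mem_shiftSet_iff] at hμ
  rcases hμ with h | h | h | h <;> simp only [Prod.mk.injEq] at h <;> obtain ⟨rfl, rfl, rfl⟩ := h <;>
    fin_cases i₁ <;> fin_cases i₂ <;> fin_cases i₃ <;> simp

/-- **Cancellation (4.3)** of the seeded graded Toda table (any seed `ε`): its quadratic part
conserves `Σ_n (a_n² + v_n²)`.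
[cite: Tao2016AveragedNS, §4 (4.3); cell theorem] -/
theorem seededToda_isCancellingCoeff (ε : ℝ) :
    IsCancellingCoeff (m := 4) (fun (i₁ i₂ i₃ : Fin 4) (μ : ℤ × ℤ × ℤ) =>
      if μ = ((0 : ℤ), (0 : ℤ), (0 : ℤ)) then
        (if i₁ = 1 ∧ i₂ = 1 ∧ i₃ = 0 then (-1 : ℝ) else if i₁ = 1 ∧ i₂ = 0 ∧ i₃ = 1 then 1 / 2
         else if i₁ = 0 ∧ i₂ = 1 ∧ i₃ = 1 then 1 / 2 else if i₁ = 0 ∧ i₂ = 0 ∧ i₃ = 1 then ε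
         else if i₁ = 0 ∧ i₂ = 1 ∧ i₃ = 0 then -ε / 2 else if i₁ = 1 ∧ i₂ = 0 ∧ i₃ = 0 then -ε / 2 else 0)
      else if μ = ((0 : ℤ), (0 : ℤ), (1 : ℤ)) then (if i₁ = 1 ∧ i₂ = 1 ∧ i₃ = 0 then 1 else 0)
      else if μ = ((0 : ℤ), (1 : ℤ), (0 : ℤ)) then (if i₁ = 1 ∧ i₂ = 0 ∧ i₃ = 1 then -1 / 2 else 0)
      else if μ = ((1 : ℤ), (0 : ℤ), (0 : ℤ)) then (if i₁ = 0 ∧ i₂ = 1 ∧ i₃ = 1 then -1 / 2 else 0)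
      else 0) := by
  intro i₁ i₂ i₃ μ₁ μ₂ μ₃ hμ
  rw [mem_shiftSet_iff] at hμ
  rcases hμ with h | h | h | h <;> simp only [Prod.mk.injEq] at h <;> obtain ⟨rfl, rfl, rfl⟩ := h <;>
    fin_cases i₁ <;> fin_cases i₂ <;> fin_cases i₃ <;> norm_num <;> ring

/-- **`2/ε`-comparability** of the seeded graded Toda table for `0 < ε ≤ 1`: its structure constants
are `0, ±1, ±½, ε, −ε/2`, all of modulus `≤ 1` and, when non-zero, `≥ ε/2`.
[cite: Tao2016AveragedNS, §6.1 (comparison of structure constants); cell theorem] -/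
theorem seededToda_isComparableCoeff {ε : ℝ} (hε : 0 < ε) (hε1 : ε ≤ 1) :
    IsComparableCoeff (2 / ε) (m := 4) (fun (i₁ i₂ i₃ : Fin 4) (μ : ℤ × ℤ × ℤ) =>
      if μ = ((0 : ℤ), (0 : ℤ), (0 : ℤ)) then
        (if i₁ = 1 ∧ i₂ = 1 ∧ i₃ = 0 then (-1 : ℝ) else if i₁ = 1 ∧ i₂ = 0 ∧ i₃ = 1 then 1 / 2
         else if i₁ = 0 ∧ i₂ = 1 ∧ i₃ = 1 then 1 / 2 else if i₁ = 0 ∧ i₂ = 0 ∧ i₃ = 1 then ε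
         else if i₁ = 0 ∧ i₂ = 1 ∧ i₃ = 0 then -ε / 2 else if i₁ = 1 ∧ i₂ = 0 ∧ i₃ = 0 then -ε / 2 else 0)
      else if μ = ((0 : ℤ), (0 : ℤ), (1 : ℤ)) then (if i₁ = 1 ∧ i₂ = 1 ∧ i₃ = 0 then 1 else 0)
      else if μ = ((0 : ℤ), (1 : ℤ), (0 : ℤ)) then (if i₁ = 1 ∧ i₂ = 0 ∧ i₃ = 1 then -1 / 2 else 0)
      else if μ = ((1 : ℤ), (0 : ℤ), (0 : ℤ)) then (if i₁ = 0 ∧ i₂ = 1 ∧ i₃ = 1 then -1 / 2 else 0)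
      else 0) := by
  intro i₁ i₂ i₃ μ _hμ
  have hR : (2 / ε)⁻¹ = ε / 2 := by rw [inv_div]
  rw [hR]
  dsimp only
  split_ifs <;>
    first
    | exact ⟨by simp, Or.inl rfl⟩
    | (refine ⟨?_, Or.inr ?_⟩ <;>
        simp only [abs_neg, abs_div, abs_one, Nat.abs_ofNat, abs_of_pos hε] <;> linarith)

/-- **The seeded graded Toda member `T_ε` lies in `E₂(2/ε)`** (`InTableClass (2/ε)`) for
`0 < ε ≤ 1` — the «Toda member» of the route text, and the table of `PerpetualPump.CircuitPump`.
[cite: Tao2016AveragedNS, §4 (4.2)–(4.3), §6.1; cell theorem] -/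
theorem inTableClass_seededToda {ε : ℝ} (hε : 0 < ε) (hε1 : ε ≤ 1)
    {α : Fin 4 → Fin 4 → Fin 4 → ℤ × ℤ × ℤ → ℝ} (hα : α = (fun (i₁ i₂ i₃ : Fin 4) (μ : ℤ × ℤ × ℤ) =>
      if μ = ((0 : ℤ), (0 : ℤ), (0 : ℤ)) then
        (if i₁ = 1 ∧ i₂ = 1 ∧ i₃ = 0 then (-1 : ℝ) else if i₁ = 1 ∧ i₂ = 0 ∧ i₃ = 1 then 1 / 2
         else if i₁ = 0 ∧ i₂ = 1 ∧ i₃ = 1 then 1 / 2 else if i₁ = 0 ∧ i₂ = 0 ∧ i₃ = 1 then ε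
         else if i₁ = 0 ∧ i₂ = 1 ∧ i₃ = 0 then -ε / 2 else if i₁ = 1 ∧ i₂ = 0 ∧ i₃ = 0 then -ε / 2 else 0)
      else if μ = ((0 : ℤ), (0 : ℤ), (1 : ℤ)) then (if i₁ = 1 ∧ i₂ = 1 ∧ i₃ = 0 then 1 else 0)
      else if μ = ((0 : ℤ), (1 : ℤ), (0 : ℤ)) then (if i₁ = 1 ∧ i₂ = 0 ∧ i₃ = 1 then -1 / 2 else 0)
      else if μ = ((1 : ℤ), (0 : ℤ), (0 : ℤ)) then (if i₁ = 0 ∧ i₂ = 1 ∧ i₃ = 1 then -1 / 2 else 0)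
      else 0)) :
    InTableClass (2 / ε) α := by
  subst hα
  exact ⟨seededToda_isSymmetricCoeff ε, seededToda_isCancellingCoeff ε,
    seededToda_isComparableCoeff hε hε1⟩

/-- **The unseeded member `T_0` lies in `E₂(2)`.**
[cite: Tao2016AveragedNS, §4 (4.2)–(4.3), §6.1; cell theorem] -/
theorem inTableClass_unseededToda {ε : ℝ} (hε : ε = 0)
    {α : Fin 4 → Fin 4 → Fin 4 → ℤ × ℤ × ℤ → ℝ} (hα : α = (fun (i₁ i₂ i₃ : Fin 4) (μ : ℤ × ℤ × ℤ) =>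
      if μ = ((0 : ℤ), (0 : ℤ), (0 : ℤ)) then
        (if i₁ = 1 ∧ i₂ = 1 ∧ i₃ = 0 then (-1 : ℝ) else if i₁ = 1 ∧ i₂ = 0 ∧ i₃ = 1 then 1 / 2
         else if i₁ = 0 ∧ i₂ = 1 ∧ i₃ = 1 then 1 / 2 else if i₁ = 0 ∧ i₂ = 0 ∧ i₃ = 1 then ε
         else if i₁ = 0 ∧ i₂ = 1 ∧ i₃ = 0 then -ε / 2 else if i₁ = 1 ∧ i₂ = 0 ∧ i₃ = 0 then -ε / 2 else 0)
      else if μ = ((0 : ℤ), (0 : ℤ), (1 : ℤ)) then (if i₁ = 1 ∧ i₂ = 1 ∧ i₃ = 0 then 1 else 0)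
      else if μ = ((0 : ℤ), (1 : ℤ), (0 : ℤ)) then (if i₁ = 1 ∧ i₂ = 0 ∧ i₃ = 1 then -1 / 2 else 0)
      else if μ = ((1 : ℤ), (0 : ℤ), (0 : ℤ)) then (if i₁ = 0 ∧ i₂ = 1 ∧ i₃ = 1 then -1 / 2 else 0)
      else 0)) :
    InTableClass 2 α := by
  subst hα; subst hε
  refine ⟨seededToda_isSymmetricCoeff 0, seededToda_isCancellingCoeff 0, fun i₁ i₂ i₃ μ _hμ => ?_⟩
  dsimp only
  split_ifs <;> norm_num

/-! ## Coordinates of the structure maps (any `m = 4` table) and the drive of `T_ε` -/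

/-- Coordinates of the intra-shell map: `(tableQ α x)_j = qform α (0,0,0) x x j`.
[cite: Tao2016AveragedNS, §4 (4.1), Lemma 4.1 (4.8); cell vocabulary] -/
theorem tableQ_apply (α : Fin 4 → Fin 4 → Fin 4 → ℤ × ℤ × ℤ → ℝ) (x : Em 4) (j : Fin 4) :
    tableQ α x j = qform α (0, 0, 0) x x j := by
  unfold tableQ
  fin_cases j <;> simp [Fin.sum_univ_four]

/-- Coordinates of the feed: `(tableA α x)_j = qform α (0,0,1) x x j`.
[cite: Tao2016AveragedNS, §4 (4.1), Lemma 4.1 (4.8); cell vocabulary] -/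
theorem tableA_apply (α : Fin 4 → Fin 4 → Fin 4 → ℤ × ℤ × ℤ → ℝ) (x : Em 4) (j : Fin 4) :
    tableA α x j = qform α (0, 0, 1) x x j := by
  unfold tableA
  fin_cases j <;> simp [Fin.sum_univ_four]

/-- Coordinates of the drain: `(tableB α y x)_j = qform α (1,0,0) y x j + qform α (0,1,0) x y j`.
[cite: Tao2016AveragedNS, §4 (4.1), Lemma 4.1 (4.8); cell vocabulary] -/
theorem tableB_apply (α : Fin 4 → Fin 4 → Fin 4 → ℤ × ℤ × ℤ → ℝ) (y x : Em 4) (j : Fin 4) :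
    tableB α y x j = qform α (1, 0, 0) y x j + qform α (0, 1, 0) x y j := by
  unfold tableB
  fin_cases j <;> simp [Fin.sum_univ_four]

/-- The four coordinate forms of `T_ε` in closed form.
[cite: Tao2016AveragedNS, §4 (4.1); cell theorem] -/
theorem seededToda_qform {ε : ℝ} {α : Fin 4 → Fin 4 → Fin 4 → ℤ × ℤ × ℤ → ℝ} (hα : α = (fun (i₁ i₂ i₃ : Fin 4) (μ : ℤ × ℤ × ℤ) =>
      if μ = ((0 : ℤ), (0 : ℤ), (0 : ℤ)) then
        (if i₁ = 1 ∧ i₂ = 1 ∧ i₃ = 0 then (-1 : ℝ) else if i₁ = 1 ∧ i₂ = 0 ∧ i₃ = 1 then 1 / 2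
         else if i₁ = 0 ∧ i₂ = 1 ∧ i₃ = 1 then 1 / 2 else if i₁ = 0 ∧ i₂ = 0 ∧ i₃ = 1 then ε
         else if i₁ = 0 ∧ i₂ = 1 ∧ i₃ = 0 then -ε / 2 else if i₁ = 1 ∧ i₂ = 0 ∧ i₃ = 0 then -ε / 2 else 0)
      else if μ = ((0 : ℤ), (0 : ℤ), (1 : ℤ)) then (if i₁ = 1 ∧ i₂ = 1 ∧ i₃ = 0 then 1 else 0)
      else if μ = ((0 : ℤ), (1 : ℤ), (0 : ℤ)) then (if i₁ = 1 ∧ i₂ = 0 ∧ i₃ = 1 then -1 / 2 else 0)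
      else if μ = ((1 : ℤ), (0 : ℤ), (0 : ℤ)) then (if i₁ = 0 ∧ i₂ = 1 ∧ i₃ = 1 then -1 / 2 else 0)
      else 0))
    (y x : Em 4) (j : Fin 4) :
    qform α (0, 0, 0) y x j = (if j = 0 then -(y 1 * x 1) - ε / 2 * (y 0 * x 1) - ε / 2 * (y 1 * x 0)
      else if j = 1 then 1 / 2 * (y 1 * x 0) + 1 / 2 * (y 0 * x 1) + ε * (y 0 * x 0) else 0) ∧
    qform α (0, 0, 1) y x j = (if j = 0 then y 1 * x 1 else 0) ∧
    qform α (0, 1, 0) y x j = (if j = 1 then -(1 / 2) * (y 1 * x 0) else 0) ∧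
    qform α (1, 0, 0) y x j = (if j = 1 then -(1 / 2) * (y 0 * x 1) else 0) := by
  subst hα
  refine ⟨?_, ?_, ?_, ?_⟩ <;> fin_cases j <;> simp [qform, Fin.sum_univ_four] <;> ring

/-- **Drive coordinates of the seeded Toda member.**  For shell vectors `x` (this shell), `z` (shell
behind, feeding through `A`) and `y` (shell ahead, draining through `B`), the quadratic drive
`Q(x) + Λ A(z) + Λ⁻¹ B(y,x)` has carrier coordinate `Λ z₁² − x₁² − ε x₀x₁`, bond coordinate
`(x₀ − Λ⁻¹ y₀) x₁ + ε x₀²`, and zero coordinates `2, 3` — i.e. the Toda system of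
`PerpetualPumpCircuitPumpClockBoxTable` (`ȧ = … − v² + Λ v₋² − ε a v`, `v̇ = … + v(a − a₊) + ε a²`,
the drain carrying the tree's weight `Λ⁻¹` in renormalised variables).
[cite: Tao2016AveragedNS, §4 (4.1), Lemma 4.1 (4.8); cell theorem] -/
theorem seededToda_drive {ε : ℝ} {α : Fin 4 → Fin 4 → Fin 4 → ℤ × ℤ × ℤ → ℝ} (hα : α = (fun (i₁ i₂ i₃ : Fin 4) (μ : ℤ × ℤ × ℤ) =>
      if μ = ((0 : ℤ), (0 : ℤ), (0 : ℤ)) then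
        (if i₁ = 1 ∧ i₂ = 1 ∧ i₃ = 0 then (-1 : ℝ) else if i₁ = 1 ∧ i₂ = 0 ∧ i₃ = 1 then 1 / 2
         else if i₁ = 0 ∧ i₂ = 1 ∧ i₃ = 1 then 1 / 2 else if i₁ = 0 ∧ i₂ = 0 ∧ i₃ = 1 then ε
         else if i₁ = 0 ∧ i₂ = 1 ∧ i₃ = 0 then -ε / 2 else if i₁ = 1 ∧ i₂ = 0 ∧ i₃ = 0 then -ε / 2 else 0)
      else if μ = ((0 : ℤ), (0 : ℤ), (1 : ℤ)) then (if i₁ = 1 ∧ i₂ = 1 ∧ i₃ = 0 then 1 else 0)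
      else if μ = ((0 : ℤ), (1 : ℤ), (0 : ℤ)) then (if i₁ = 1 ∧ i₂ = 0 ∧ i₃ = 1 then -1 / 2 else 0)
      else if μ = ((1 : ℤ), (0 : ℤ), (0 : ℤ)) then (if i₁ = 0 ∧ i₂ = 1 ∧ i₃ = 1 then -1 / 2 else 0)
      else 0))
    (Λ : ℝ) (x y z : Em 4) :
    (tableQ α x + Λ • tableA α z + Λ⁻¹ • tableB α y x) 0
        = Λ * (z 1 * z 1) - x 1 * x 1 - ε * (x 0 * x 1) ∧
    (tableQ α x + Λ • tableA α z + Λ⁻¹ • tableB α y x) 1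
        = (x 0 - Λ⁻¹ * y 0) * x 1 + ε * (x 0 * x 0) ∧
    (tableQ α x + Λ • tableA α z + Λ⁻¹ • tableB α y x) 2 = 0 ∧
    (tableQ α x + Λ • tableA α z + Λ⁻¹ • tableB α y x) 3 = 0 := by
  have hQ := fun (y x : Em 4) (j : Fin 4) => (seededToda_qform hα y x j).1
  have hA := fun (y x : Em 4) (j : Fin 4) => (seededToda_qform hα y x j).2.1
  have hB₁ := fun (y x : Em 4) (j : Fin 4) => (seededToda_qform hα y x j).2.2.1
  have hB₂ := fun (y x : Em 4) (j : Fin 4) => (seededToda_qform hα y x j).2.2.2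
  refine ⟨?_, ?_, ?_, ?_⟩ <;>
    simp only [PiLp.add_apply, PiLp.smul_apply, smul_eq_mul, tableQ_apply, tableA_apply,
      tableB_apply, hQ, hA, hB₁, hB₂] <;> simp <;> ring

end WakeRatchetSeededToda

end Summit.NavierStokesRegularity.NavierStokesRegularity.Theorems

end
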